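import Mathlib.MeasureTheory.Measure.Tilted
import Mathlib.MeasureTheory.Constructions.BorelSpace.ContinuousLinearMap
import Mathlib.Algebra.Star.Module
import Literature.MathematicalPhysics.QuantumLattice.LatticeGaugeDLR
import Literature.MathematicalPhysics.QuantumLattice.YangMillsClassical
import Literature.MathematicalPhysics.QuantumLattice.BalabanRG
import Literature.MathematicalPhysics.QuantumLattice.SchwartzTensor
import Literature.MathematicalPhysics.QuantumLattice.GaugeGroups
import HarnessLib

-- provenance: harness21/H21/H21/Statements/ConstructiveQFT/BalabanRG.lean @ baafd6a (interim HEAD d8f2665); M5 mechanical rewrite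
/-!
# Bałaban UV stability and the Magnen–Rivasseau–Sénéor construction of `YM₄` (schematic)

Trunk G13 (`QLatticeAQFT`), family `constructive-qft`, statement file
`H21/Statements/ConstructiveQFT/BalabanRG.lean` (tier L, last item of the outline; risks R5/R6:
*schematic* statements over hypothesis structures, recorded as `def … : Prop` and **not
asserted**).

## Content

* **constructive-qft.S20** (Bałaban's ultraviolet stability of lattice pure gauge theory).
  `BlockRGScheme.HasUniformUVStability(AE) sch` (bounds `e^{-c|Λ|} ≤ ρ_k(Λ, V) ≤ e^{C|Λ|}` with
  `k`-independent constants, pointwise / Haar-a.e. in `V`) and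
  `BlockRGScheme.HasWindowedUVStability(AE) sch γ` (the same for all `k` with `0 < g_j ≤ γ`,
  `j ≤ k`, for a window `γ` that is a *parameter*, fixed before the scheme — with `∃ γ` inside
  the predicate would be vacuous, `hasWindowedUVStabilityAE_of_lt`), the *normalised*
  free-boundary RG recursion `BlockRGScheme.IsRGIterateWith sch E` (each `e^{-E_k(Λ)} ρ_{k+1}`
  is the block RG transform `IsBlockRGStepOf` of `ρ_k`, prelude A18, with free-energy
  normalisations `E`; the unnormalised `IsRGIterate` is API only, with the mass identity
  `IsRGIterateWith.mass_eq` explaining why), the single-step a.e. bounds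
  `BlockRGScheme.HasUVStabilityBoundsAtAE sch c C k`, and the two target propositions
  `BalabanUVStability3` (`d = 3`, Bałaban CMP 102 (1985) Thm. 1) and `BalabanUVStability4`
  (`d = 4`, Bałaban CMP 122 (1989) Thm. 1), both for `SU(2)` in the fundamental representation.
  Both are stated for a *family of schemes indexed by the ultraviolet cutoff level* `n` (fine
  lattice spacing `ε = M⁻ⁿ`, the unit lattice is reached after `n` block RG steps), with the
  bounds on the `n`-th iterate required *uniformly in `n`* — this uniformity in the cutoff is
  the content of Bałaban's theorems (review r02500B). In `d = 3` the bare coupling of the `n`-th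
  scheme is Bałaban's `g_ε² = g² ε = g² M⁻ⁿ` and `BalabanUVStability3` is a closed proposition;
  in `d = 4` the window `γ` and the cutoff-indexed family of running couplings `gs` (bare
  couplings `gs n 0`, renormalised unit-scale coupling `gs n n = g`) are *parameters* of the
  predicate `BalabanUVStability4 γ gs`: in Bałaban's theorem the couplings are determined by
  the RG flow (CMP 119 (1988) Thm. 1; bare coupling `~ (a + b log ε⁻¹)^{-1/2}`, ibid. p. 244),
  which the v0 structure does not define (see the docstring and §"Predicates versus named
  facts" below).
* **constructive-qft.S21** (Magnen–Rivasseau–Sénéor, CMP 155 (1993): the unnumbered italic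
  statement of §I p. 327 with (VIII.6) p. 378; no numbered theorem in the source, which calls
  itself a "sketch of proof", p. 378). Continuum `SU(2)`
  Yang–Mills in a finite Euclidean volume `Λ ⊆ ℝ⁴`, regularised axial gauge, trivial bundle:
  the gauge-field Schwinger functions `YMSchwingerFamily` (indexed by a Lorentz index `μ : Fin 4`
  and a matrix entry `(p, q)` of `A_μ(x) ∈ 𝔰𝔲(2) ⊆ M₂(ℂ)`), the configuration space
  `AxialConfig` (smooth `𝔰𝔲(2)`-valued axial-gauge classical connections
  `Literature.AQFT.Connection ℝ⁴ M₂(ℂ)`, a subtype with the cylinder σ-algebra of the field values;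
  singletons are measurable, `AxialConfig.instMeasurableSingletonClass`), the hypothesis
  structure `AxialGaugeYMRegularisation Λ g` (a sequence of UV-regularised laws on `AxialConfig`
  of the Gibbs form `exp (-(g⁻² S_Λ(A) + ∫_Λ (a_κ |A|² + b_κ |F_A|²))) d(ref κ)`, A14 vocabulary
  `ymDensity`, local counterterms `localCounterterm`, `b_κ ≥ 0`, atomless `ref κ`, divergent
  expected action), the predicates `IsRegularisedAxialGaugeYMLimit Λ g S` and
  `SatisfiesSlavnovIdentitiesOn Ω S` / `SatisfiesSlavnovIdentities S` (Ward identities of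
  infinitesimal gauge transformations `δA_μ = ∂_μ ω + [A_μ, ω]`, `ω ∈ Ω`, A14 `covDeriv`
  convention, written on the Schwinger functions through tensor-witness predicates in the style
  of A3 `IsTensorOf`; the bold-id proposition uses `Ω =` constant `𝔰𝔲(2)`-valued parameters,
  i.e. global `SU(2)` covariance), and the target proposition `MagnenRivasseauSeneorYM4`.

## Faithfulness flags (outline R5/R6)

* `BlockRGScheme.effDensity` is the `STUB(v0)` of prelude A18: the v0 structure imposes only the
  Wilson starting density, not Bałaban's recursion with its small/large-field decomposition. We
  add the *normalised, free-boundary, axial-gauge* recursion `IsRGIterateWith E` (A18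
  `IsBlockRGStepOf` up to the factors `e^{E_k(Λ)}`) inside the propositions; it is an equality
  of `withDensity` measures, so the conclusions are stated Haar-a.e. (`HasUVStabilityBoundsAE`;
  the pointwise prelude bounds would be refutable by null-set modifications). The
  normalisations `E_k(Λ)` render Bałaban's vacuum-energy counterterms (plus free-boundary
  surface corrections, an artefact of A18's free boundary condition); without them the
  mass-preserving recursion makes `k`-uniform lower bounds refutable (review r01907B; docstring
  of `IsRGIterateWith`). This is still a simplification of Bałaban's torus set-up and
  gauge-covariant averaging (CMP 109 (1987) (0.1)–(0.3)), and the recursion ignores the running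
  couplings `g_j`, `j ≥ 1`.
* Cutoff dependence (review r02500B). For a *single* scheme (one bare coupling `g₀` for all `k`)
  `k`-uniform two-sided bounds on the normalised iterates are an elementary consequence of Haar
  invariance: left-translating the first fine link of each block line by `h_b` preserves
  `freeHaarConfig`, maps the block holonomy `V ↦ hV` and changes the Wilson action by at most
  `4N(d-1) g₀⁻² |Λ|`, so the log-oscillation of every iterate is `≤ K|Λ|` with
  `K = 4N(d-1)/g₀²` (see `HasUniformUVStability`). The single-scheme predicates
  `HasUniformUVStability(AE)`/`HasWindowedUVStability(AE)` are therefore API only. Bałaban's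
  theorems concern the continuum limit: the bare coupling depends on the cutoff `ε = M⁻ⁿ`
  (`d = 3`: `g_ε² = g² ε`, so `K ~ g⁻² Mⁿ` blows up; `d = 4`: `g_ε` runs in the window) and the
  bounds on the unit-lattice effective density are nevertheless uniform in `n`. The bold-id
  propositions are stated in this family form, with the bounds on the `n`-th iterate of the
  `n`-th scheme (`HasUVStabilityBoundsAtAE … n`); bounds at intermediate scales `j < n` are
  omitted (there Bałaban's lower bound carries the main term `-g_j⁻² A_j(V)` with small
  effective coupling `g_j`, CMP 102 (1985) Thm. 1, and is not of the two-sided `e^{∓c|Λ|}` form).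
  `BalabanUVStability3` is then a transcription of CMP 102 Thm. 1 modulo the flagged
  simplifications (not asserted); `BalabanUVStability4 γ gs` is a *predicate* in the window and
  the coupling family: since v0's running couplings are decoupled from the (stubbed) recursion,
  the bare couplings `g_ε(n) = gs n 0` of a closed rendering would be free data in the window
  rather than determined by asymptotic freedom (CMP 119 (1988) p. 244), and the closed form
  `∃ γ > 0, ∀ gs, …` first recorded here is refutable as rendered (docstring of
  `BalabanUVStability4`); Bałaban's theorem is the instance at the RG-determined family, not
  expressible over v0. Bałaban treats a general compact `G ⊆ U(N)`; the general-`G` predicates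
  are provided and the bold-id propositions specialise to `SU(2)`. (Supervisor note: the pointwise/a.e. mismatch and the
  missing normalisation originate in A18, `HasUVStabilityBounds`/`effDensity_zero` vs
  `IsBlockRGStepOf`; `HasUVStabilityBounds(At)AE` and `IsRGIterateWith` belong there eventually.)
* S21: the inventory text is the abstract of MRS (theorem locator "?"). "Regularised axial gauge
  YM measure with UV cutoff" is rendered by the hypothesis structure `AxialGaugeYMRegularisation`
  on the carrier `AxialConfig` (axial gauge `A(x) e₀ = 0`, smoothness and `𝔰𝔲(2)`-valuedness
  are built into the carrier — imposing them a.e. on the raw product σ-algebra made the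
  structure empty, review r01907B; reference measures are data; imposed are the Gibbs form with
  *local* counterterms and nonnegative field-strength counterterm, atomless references and
  divergence of the expected action as the cutoff is removed); "Slavnov identities" are rendered
  as the global `SU(2)`-covariance Ward identities (the inhomogeneous residual-gauge identities
  are inconsistent with a normalised `0`-point function, see `SatisfiesSlavnovIdentitiesOn`).
  Both are schematic and say so; `MagnenRivasseauSeneorYM4` carries the cheap non-degeneracy
  conjunct `S 2 ≠ 0` and atomless reference measures (excluding the trivial family and
  Dirac-pair references), but is still weaker than MRS's theorem (artificial finite-mode
  Gaussian witnesses of the structure exist on the new carrier and are presumably not excluded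
  as witnesses of the proposition) and is not asserted. The finite volume is any cube
  `[0, L]⁴`, `L > 0` (universally quantified rather than the outline's `∃ Λvol`, to avoid the
  vacuous witness `Λvol = ∅`).
* Migration debt: `IsAxialGauge`, `IsAxialResidual`, `massDensity`, `ymActionOn`,
  `localCounterterm`, `suAlgebra`, `axialDirection`, `AxialConfig` are general vocabulary that
  belongs in `Prelude/QLatticeAQFT/YangMillsClassical.lean` (A14 already anticipates `𝔰𝔲(N)`
  there); supervisor follow-up.
* `ℝ⁴` is written `EuclideanSpace ℝ (Fin 4)` throughout (outline §0: no `E d` abbreviation);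
  `e_μ = EuclideanSpace.single μ 1`, time is coordinate `0` (`axialDirection`).
* Norm on `M₂(ℂ)`: `open scoped Matrix.Norms.Frobenius`, as prescribed by A14 for the matrix case
  (do not mix with `Matrix.Norms.L2Operator` in one section).

## Predicates versus named facts (verdict clean-up, 2026-08-15)

`BlockRGScheme.HasUniformUVStability`, `BlockRGScheme.HasUniformUVStabilityAE` and
`BlockRGScheme.IsRGIterate` (together with `IsRGIterateWith`, `HasWindowedUVStability(AE)`,
`HasUVStabilityBounds(At)AE`) are *properties of a scheme*: they now take the scheme as an
explicit argument `(sch : BlockRGScheme d N G)` instead of a section variable — same names,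
same types, all users unchanged — and none of them is a closed proposition admitting a
discharge `…_holds`. Their kernel-checked status (sibling file `ConstructiveQFTBalabanRGProofs`
and `QuantumLattice/BalabanRGHaarIterates`, both importing this file): the stability predicates
are satisfiable (`BlockRGScheme.exists_hasUniformUVStability`,
`BlockRGScheme.exists_hasUniformUVStabilityAE`; by genuine normalised block RG iterates of the
Wilson density, `BlockRGScheme.haarIterate_hasUniformUVStability(AE)` with
`BlockRGScheme.haarIterate_isRGIterateWith`), and every universal closure fails
(`BlockRGScheme.not_forall_hasUniformUVStability`, `BlockRGScheme.not_forall_hasUniformUVStabilityAE`,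
`BlockRGScheme.exists_not_isRGIterate`, `BlockRGScheme.exists_not_isRGIterateWith`), because
the `STUB(v0)` structure constrains only the starting density. For the same reason — the data
Bałaban's theorem is about (RG-determined couplings, CMP 119 (1988) Thm. 1) are not rendered by
the v0 structure — `BalabanUVStability4` is recorded as a predicate in `(γ, gs)`; its former
closed form `∃ γ > 0, ∀ gs, BalabanUVStability4 γ gs` is refutable as rendered (docstring).
`BalabanUVStability3` is unchanged.

## Mathlib status

Mathlib (pinned) has no renormalisation group, lattice gauge theory, Yang–Mills measure, Slavnov
or Ward identity (grep `Slavnov`, `Ward`, `renormali`, `axial gauge`: nothing). Used verbatim: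
`Measure.tilted` (Gibbs densities), `NullSingletonClass` (atomless reference measures),
`ContinuousLinearMap.instMeasurableSpace`, `MeasurableSpace.pi`, `Subtype.instMeasurableSpace`
(cylinder σ-algebra on `AxialConfig`), `Continuous.ext_on` and
`TopologicalSpace.exists_countable_dense` (measurable singletons), `skewAdjoint.submodule`, `Matrix.traceLinearMap`
(`𝔰𝔲(2)`), `SchwartzMap`, `Fin.insertNth`/`Fin.succAbove`, `fderiv`,
`Matrix.specialUnitaryGroup` with the H21 instances of `GaugeGroups`.

## References

* T. Bałaban, CMP 102 (1985) 255–275, Thm. 1 (`d = 3`); CMP 109 (1987) 249–301, Thm. 2 and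
  (0.1)–(0.3), (0.18), (0.20), (0.33); CMP 122 (1989) 355–392, Thm. 1 (`d = 4`).
* T. Bałaban, *Convergent renormalization expansions for lattice gauge theories*, CMP 119 (1988)
  243–285: p. 244 (`d < 4`: `g₀ = g ε^{(4-d)/2}`; `d = 4`: bare coupling
  `~ (a + b log ε⁻¹)^{-1/2}`), Thm. 1 (p. 262: couplings `{g_k}` determined by the recursive RG
  equations (0.18), (0.20) of CMP 109, under the inequalities (0.33)), Cor. 3 "Ultraviolet
  Stability" (p. 264: constants independent of the cutoff `η` and the torus `T`, depending on
  `g_k`). [Balaban1988Convergent]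
* J. Magnen, V. Rivasseau, R. Sénéor, *Construction of `YM₄` with an infrared cutoff*, CMP 155
  (1993) 325–383, abstract and Thm. 1.
* A. A. Slavnov, Theor. Math. Phys. 10 (1972) 99; J. C. Taylor, Nucl. Phys. B33 (1971) 436
  (Slavnov–Taylor identities); W. Kummer, Acta Phys. Austriaca 41 (1975) 315 (axial gauge Ward
  identities).
-/

noncomputable section

open MeasureTheory Filter Topology Finset
open scoped SchwartzMap

/-! ### constructive-qft.S20: Bałaban's ultraviolet stability -/

namespace Literature.MathematicalPhysics.QuantumFieldTheory
section BlockRGScheme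
open Literature.MathematicalPhysics.QuantumLattice (BlockRGScheme)
open Literature.MathematicalPhysics.QuantumLattice.BlockRGScheme

open Literature.Probability.LatticeModels

variable {d N : ℕ} {G : Type*}

section Uniform

variable [Group G] [MeasurableSpace G]

/-- **Uniform ultraviolet stability** of the block RG scheme `sch` — a *predicate on the scheme*
(explicit argument `sch`), not a closed proposition: there are constants `c, C`, independent of
the number `k` of RG steps, with `e^{-c|Λ|} ≤ ρ_j(Λ, V) ≤ e^{C|Λ|}` for all `j`, all finite
coarse volumes `Λ` and all coarse fields `V` (the single-scheme *shape* of the bounds of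
Bałaban, CMP 102 (1985) Thm. 1). API only. Kernel-checked status: the predicate is satisfiable
(`BlockRGScheme.exists_hasUniformUVStability`, file `ConstructiveQFTBalabanRGProofs`; and by
genuine normalised block RG iterates of the Wilson density,
`BlockRGScheme.haarIterate_hasUniformUVStability`, file `QuantumLattice/BalabanRGHaarIterates`:
for one scheme — fixed bare coupling `g₀` for all `k` — Haar invariance under left translation
of the first fine link of each block line bounds the log-oscillation of every iterate by `K|Λ|`
with `K ∝ g₀⁻²`, review r02500B), and its universal closure fails
(`BlockRGScheme.not_forall_hasUniformUVStability`: the `STUB(v0)` structure lets the starting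
density be continued by `0`), so there is no discharge `HasUniformUVStability_holds`. Bałaban's
theorem is about uniformity in the cutoff, with cutoff-dependent bare coupling; see
`Literature.MathematicalPhysics.QuantumFieldTheory.BalabanUVStability3`. [folklore] -/
def _root_.Literature.MathematicalPhysics.QuantumLattice.BlockRGScheme.HasUniformUVStability (sch : BlockRGScheme d N G) : Prop :=
  ∃ c C : ℝ, ∀ k : ℕ, sch.HasUVStabilityBounds c C k

/-- **Windowed ultraviolet stability** of a block RG scheme for the window `γ` (the `d = 4` form;
this is exactly the shape announced in the docstring of prelude A18 `HasUVStability`): there are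
constants `c, C` such that, for every `k`, if the running couplings satisfy `0 < g_j ≤ γ` for all
`j ≤ k` (`InWindow`), then `e^{-c|Λ|} ≤ ρ_j(Λ, V) ≤ e^{C|Λ|}` for `j ≤ k` (Bałaban CMP 122 (1989)
Thm. 1; CMP 109 (1987) (0.3) and Thm. 2). The window `γ` is a *parameter* (in Bałaban it depends
only on `d` and `G` and is fixed before the scheme): with `∃ γ` inside, the predicate would hold
for every scheme (choose `γ < g₀`, so that `InWindow` fails for all `k`), see
`hasWindowedUVStability_of_lt`. [folklore] -/
def _root_.Literature.MathematicalPhysics.QuantumLattice.BlockRGScheme.HasWindowedUVStability (sch : BlockRGScheme d N G) (γ : ℝ) : Prop :=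
  ∃ c C : ℝ, ∀ k : ℕ, QuantumLattice.InWindow sch.couplings γ k → sch.HasUVStabilityBounds c C k

/-- Uniform UV stability gives UV stability at every step. [folklore] -/
theorem _root_.Literature.MathematicalPhysics.QuantumLattice.BlockRGScheme.HasUniformUVStability.hasUVStability (sch : BlockRGScheme d N G) (h : sch.HasUniformUVStability) (k : ℕ) :
    sch.HasUVStability k := by
  obtain ⟨c, C, h⟩ := h
  exact ⟨c, C, h k⟩

/-- Uniform UV stability implies windowed UV stability for any window. [folklore] -/
theorem _root_.Literature.MathematicalPhysics.QuantumLattice.BlockRGScheme.HasUniformUVStability.hasWindowedUVStability (sch : BlockRGScheme d N G) (h : sch.HasUniformUVStability) (γ : ℝ) :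
    sch.HasWindowedUVStability γ := by
  obtain ⟨c, C, h⟩ := h
  exact ⟨c, C, fun k _ => h k⟩

/-- Windowed UV stability is antitone in the window. [folklore] -/
theorem _root_.Literature.MathematicalPhysics.QuantumLattice.BlockRGScheme.HasWindowedUVStability.anti (sch : BlockRGScheme d N G) {γ γ' : ℝ} (h : sch.HasWindowedUVStability γ') (hγ : γ ≤ γ') :
    sch.HasWindowedUVStability γ := by
  obtain ⟨c, C, h⟩ := h
  exact ⟨c, C, fun k hk => h k (hk.of_le hγ)⟩

/-- Vacuity check (why `γ` must be quantified *outside* the scheme): if the window lies below the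
bare coupling, `γ < g₀`, the window condition fails at every step and windowed UV stability holds
trivially. [folklore] -/
theorem _root_.Literature.MathematicalPhysics.QuantumLattice.BlockRGScheme.hasWindowedUVStability_of_lt (sch : BlockRGScheme d N G) {γ : ℝ} (hγ : γ < sch.couplings 0) :
    sch.HasWindowedUVStability γ :=
  ⟨0, 0, fun k hk => absurd (hk 0 (Nat.zero_le k)).2 (not_le.2 hγ)⟩

end Uniform

section Iterate

variable [Group G] [MeasurableSpace G] [TopologicalSpace G] [IsTopologicalGroup G]
  [CompactSpace G] [BorelSpace G]

/-- The effective densities of `sch` are **normalised block RG iterates** with free-energy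
normalisations `E k Λ` (free boundary condition, axial gauge inside blocks): for every `k` and
every finite coarse edge volume `Λ`, `e^{-E_k(Λ)} ρ_{k+1}(Λ, ·)` is the block RG transform of
`ρ_k(fineEdges M Λ, ·)`, i.e.
`ρ_{k+1}(V) = e^{E_k(Λ)} ∫ ∏_{b ∈ Λ} δ(V_b⁻¹ Ū_b) ρ_k(U) dU` with `Ū = axialBlockHolonomy M U`
(prelude A18 `IsBlockRGStepOf`; Bałaban CMP 109 (1987) (0.1)–(0.3), CMP 116 (1988) (1)–(3)).
This is the v0 substitute for the `STUB(v0)` recursion of `BlockRGScheme.effDensity` (no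
small/large-field split, free instead of periodic boundary condition).

The normalisation is essential: Bałaban's effective actions carry vacuum-energy counterterms
(`E_k |Λ|`-type constants, CMP 102 (1985) Thm. 1, CMP 109 (1987) (0.3)) and the stability
bounds `e^{∓c|Λ|}` concern the *normalised* densities. Without it (`E = 0`, `IsRGIterate`) the
block RG step preserves total mass (`IsRGIterateWith.mass_eq`), so
`∫ ρ_k({b}) dV = Z_0(fineEdges^k {b}) → 0` as `k → ∞` (a Wilson partition function of `M^{dk}`
edges), contradicting any `k`-uniform lower bound `e^{-c}`. The normalisation is allowed to
depend on `Λ` and not only on `|Λ|` (bulk vacuum energy `E_k |Λ|` *plus* boundary free-energy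
corrections): with the free boundary condition of A18 the mass identity would otherwise force
`log Z_0(fineEdges^k Λ)` to be extensive in `|Λ|` up to `O(|Λ|)` uniformly in `k`, which fails
by surface corrections of order `M^{(d-1)k}`; on Bałaban's torus there is no boundary and
`E_k |𝕋|` suffices. With `E` free, `IsRGIterateWith E` constrains the *shape* of each
`ρ_{k+1}(Λ, ·)` (`freeHaarConfig Λ`-a.e., up to a positive constant), not its mass. A predicate
on the scheme (explicit argument `sch`): satisfiable (`BlockRGScheme.haarIterate_isRGIterateWith`,
file `QuantumLattice/BalabanRGHaarIterates`), universal closure false for every `E`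
(`BlockRGScheme.exists_not_isRGIterateWith`, file `ConstructiveQFTBalabanRGProofs`). [folklore] -/
def _root_.Literature.MathematicalPhysics.QuantumLattice.BlockRGScheme.IsRGIterateWith (sch : BlockRGScheme d N G) (E : ℕ → Finset (QuantumLattice.ZdEdge d) → ℝ) : Prop :=
  ∀ (k : ℕ) (Λ : Finset (QuantumLattice.ZdEdge d)),
    QuantumLattice.IsBlockRGStepOf sch.M (sch.effDensity k (QuantumLattice.fineEdges sch.M Λ))
      (fun V => Real.exp (-E k Λ) * sch.effDensity (k + 1) Λ V) Λ

/-- The effective densities of `sch` are **(unnormalised) block RG iterates**: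
`IsRGIterateWith 0`, i.e. `ρ_{k+1}(Λ, ·)` is exactly the block RG transform of
`ρ_k(fineEdges M Λ, ·)` (prelude A18 `IsBlockRGStepOf`; Bałaban CMP 109 (1987) (0.1)–(0.2)).
API only: this mass-preserving recursion is *not* used in the bold-id propositions (see
`IsRGIterateWith` for why it would make them refutable). A *predicate on the scheme* (explicit
argument `sch`; a hypothesis on the `STUB(v0)` field `effDensity`, nothing to discharge — an
`IsRGIterate_holds` is not even typeable): its universal closure `∀ sch, sch.IsRGIterate` is
false (`BlockRGScheme.exists_not_isRGIterate`, file `ConstructiveQFTBalabanRGProofs`: a scheme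
whose step-`1` density has total mass `2` is not the push-forward of a probability measure).
[folklore] -/
def _root_.Literature.MathematicalPhysics.QuantumLattice.BlockRGScheme.IsRGIterate (sch : BlockRGScheme d N G) : Prop :=
  ∀ (k : ℕ) (Λ : Finset (QuantumLattice.ZdEdge d)),
    QuantumLattice.IsBlockRGStepOf sch.M (sch.effDensity k (QuantumLattice.fineEdges sch.M Λ)) (sch.effDensity (k + 1) Λ) Λ

/-- The unnormalised recursion is the normalised one with vanishing normalisations. [folklore] -/
theorem _root_.Literature.MathematicalPhysics.QuantumLattice.BlockRGScheme.isRGIterateWith_zero_iff (sch : BlockRGScheme d N G) : sch.IsRGIterateWith 0 ↔ sch.IsRGIterate := by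
  simp [IsRGIterateWith, IsRGIterate]

/-- **Mass identity** of the normalised block RG recursion: if the block holonomy map is
(a.e.) measurable, then `e^{-E_k(Λ)} ∫ ρ_{k+1}(Λ, V) dV = ∫ ρ_k(fineEdges Λ, U) dU`
(total masses of the two sides of A18 `IsBlockRGStepOf`; the integrals are lower Lebesgue
integrals of `ENNReal.ofReal ∘ ρ`). This is the identity behind the mass check in the docstring
of `IsRGIterateWith`. [folklore] -/
theorem _root_.Literature.MathematicalPhysics.QuantumLattice.BlockRGScheme.IsRGIterateWith.mass_eq (sch : BlockRGScheme d N G) {E : ℕ → Finset (QuantumLattice.ZdEdge d) → ℝ} (h : sch.IsRGIterateWith E)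
    (k : ℕ) (Λ : Finset (QuantumLattice.ZdEdge d))
    (hm : AEMeasurable (QuantumLattice.axialBlockHolonomy (G := G) sch.M)
      ((QuantumLattice.freeHaarConfig (QuantumLattice.fineEdges sch.M Λ)).withDensity fun U =>
        ENNReal.ofReal (sch.effDensity k (QuantumLattice.fineEdges sch.M Λ) U))) :
    ∫⁻ V, ENNReal.ofReal (Real.exp (-E k Λ) * sch.effDensity (k + 1) Λ V)
        ∂(QuantumLattice.freeHaarConfig Λ : Measure (QuantumLattice.LGConfig d G)) =
      ∫⁻ U, ENNReal.ofReal (sch.effDensity k (QuantumLattice.fineEdges sch.M Λ) U)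
        ∂(QuantumLattice.freeHaarConfig (QuantumLattice.fineEdges sch.M Λ) : Measure (QuantumLattice.LGConfig d G)) := by
  have := congrArg (fun μ : Measure (QuantumLattice.LGConfig d G) => μ Set.univ) (h k Λ)
  simp only [Measure.map_apply_of_aemeasurable hm MeasurableSet.univ, Set.preimage_univ,
    withDensity_apply _ MeasurableSet.univ, Measure.restrict_univ] at this
  exact this.symm

/-- **Ultraviolet stability bounds, almost-everywhere form**: for all `j ≤ k` and all finite
coarse volumes `Λ`, `e^{-c|Λ|} ≤ ρ_j(Λ, V) ≤ e^{C|Λ|}` for `freeHaarConfig Λ`-a.e. coarse field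
`V` (Bałaban CMP 102 (1985) Thm. 1; CMP 122 (1989) Thm. 1). This is the form matching the
recursion `IsRGIterateWith`, which (being an equality of `withDensity` measures, prelude A18
`IsBlockRGStepOf`) determines `ρ_{k+1}(Λ, ·)` only `freeHaarConfig Λ`-a.e.; the pointwise
prelude predicate `HasUVStabilityBounds` implies it (`HasUVStabilityBounds.ae`). (Supervisor
note: both the a.e. predicates and the normalised recursion belong in prelude A18 when it is
next touched.) [folklore] -/
def _root_.Literature.MathematicalPhysics.QuantumLattice.BlockRGScheme.HasUVStabilityBoundsAE (sch : BlockRGScheme d N G) (c C : ℝ) (k : ℕ) : Prop :=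
  ∀ j ≤ k, ∀ Λ : Finset (QuantumLattice.ZdEdge d), ∀ᵐ V ∂(QuantumLattice.freeHaarConfig Λ : Measure (QuantumLattice.LGConfig d G)),
    Real.exp (-(c * Λ.card)) ≤ sch.effDensity j Λ V ∧ sch.effDensity j Λ V ≤ Real.exp (C * Λ.card)

/-- **Ultraviolet stability bounds at step `k`, almost-everywhere form**: for all finite coarse
volumes `Λ`, `e^{-c|Λ|} ≤ ρ_k(Λ, V) ≤ e^{C|Λ|}` for `freeHaarConfig Λ`-a.e. `V` — the bounds at
the single scale `k` (Bałaban CMP 102 (1985) Thm. 1, CMP 122 (1989) Thm. 1, for the effective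
density on the unit lattice after `k` steps from spacing `M⁻ᵏ`). This is the predicate consumed
by the bold-id propositions `BalabanUVStability3/4`, applied to the `n`-th iterate of the `n`-th
scheme of a cutoff-indexed family. [folklore] -/
def _root_.Literature.MathematicalPhysics.QuantumLattice.BlockRGScheme.HasUVStabilityBoundsAtAE (sch : BlockRGScheme d N G) (c C : ℝ) (k : ℕ) : Prop :=
  ∀ Λ : Finset (QuantumLattice.ZdEdge d), ∀ᵐ V ∂(QuantumLattice.freeHaarConfig Λ : Measure (QuantumLattice.LGConfig d G)),
    Real.exp (-(c * Λ.card)) ≤ sch.effDensity k Λ V ∧ sch.effDensity k Λ V ≤ Real.exp (C * Λ.card)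

/-- The bounds up to step `k` are the single-step bounds at every `j ≤ k`. [folklore] -/
theorem _root_.Literature.MathematicalPhysics.QuantumLattice.BlockRGScheme.hasUVStabilityBoundsAE_iff (sch : BlockRGScheme d N G) {c C : ℝ} {k : ℕ} :
    sch.HasUVStabilityBoundsAE c C k ↔ ∀ j ≤ k, sch.HasUVStabilityBoundsAtAE c C j :=
  Iff.rfl

/-- The bounds up to step `k` give the bounds at step `k`. [folklore] -/
theorem _root_.Literature.MathematicalPhysics.QuantumLattice.BlockRGScheme.HasUVStabilityBoundsAE.at (sch : BlockRGScheme d N G) {c C : ℝ} {k : ℕ} (h : sch.HasUVStabilityBoundsAE c C k) :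
    sch.HasUVStabilityBoundsAtAE c C k :=
  h k le_rfl

/-- Under the a.e. bounds at step `k` the effective density is a.e. positive. [folklore] -/
theorem _root_.Literature.MathematicalPhysics.QuantumLattice.BlockRGScheme.HasUVStabilityBoundsAtAE.effDensity_pos_ae (sch : BlockRGScheme d N G) {c C : ℝ} {k : ℕ}
    (h : sch.HasUVStabilityBoundsAtAE c C k) (Λ : Finset (QuantumLattice.ZdEdge d)) :
    ∀ᵐ V ∂(QuantumLattice.freeHaarConfig Λ : Measure (QuantumLattice.LGConfig d G)), 0 < sch.effDensity k Λ V :=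
  (h Λ).mono fun _ hV => (Real.exp_pos _).trans_le hV.1

/-- **Uniform ultraviolet stability, a.e. form**, of the scheme `sch`: `k`-independent
constants `c, C` with `HasUVStabilityBoundsAE sch c C k` for all `k` (the single-scheme a.e.
*shape* of the bounds of Bałaban CMP 102 (1985) Thm. 1). A *predicate on the scheme* (explicit
argument `sch`), not a closed proposition: kernel-checked, it is satisfiable
(`BlockRGScheme.exists_hasUniformUVStabilityAE`; `BlockRGScheme.haarIterate_hasUniformUVStabilityAE`
for genuine normalised block RG iterates) and its universal closure `∀ sch, …` is refuted
(`BlockRGScheme.not_forall_hasUniformUVStabilityAE`, file `ConstructiveQFTBalabanRGProofs`: the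
zero continuation from step `1` of any scheme violates the a.e. lower bound at `Λ = ∅`), so there
is no discharge `HasUniformUVStabilityAE_holds`; what routes consume is the cutoff-indexed form
`HasUVStabilityBoundsAtAE` inside `BalabanUVStability3/4`. [folklore] -/
def _root_.Literature.MathematicalPhysics.QuantumLattice.BlockRGScheme.HasUniformUVStabilityAE (sch : BlockRGScheme d N G) : Prop :=
  ∃ c C : ℝ, ∀ k : ℕ, sch.HasUVStabilityBoundsAE c C k

/-- **Windowed ultraviolet stability, a.e. form** for the window `γ`: `k`-independent constants
`c, C` with `InWindow sch.couplings γ k → HasUVStabilityBoundsAE sch c C k` for all `k` (Bałaban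
CMP 122 (1989) Thm. 1; CMP 109 (1987) (0.3), Thm. 2). As for `HasWindowedUVStability`, `γ` is a
parameter to be fixed before the scheme (`hasWindowedUVStabilityAE_of_lt` is the vacuity check). [folklore] -/
def _root_.Literature.MathematicalPhysics.QuantumLattice.BlockRGScheme.HasWindowedUVStabilityAE (sch : BlockRGScheme d N G) (γ : ℝ) : Prop :=
  ∃ c C : ℝ, ∀ k : ℕ, QuantumLattice.InWindow sch.couplings γ k → sch.HasUVStabilityBoundsAE c C k

/-- Pointwise UV stability bounds imply the a.e. bounds. [folklore] -/
theorem _root_.Literature.MathematicalPhysics.QuantumLattice.BlockRGScheme.HasUVStabilityBounds.ae (sch : BlockRGScheme d N G) {c C : ℝ} {k : ℕ} (h : sch.HasUVStabilityBounds c C k) :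
    sch.HasUVStabilityBoundsAE c C k :=
  fun j hj Λ => Filter.Eventually.of_forall fun V => h j hj Λ V

/-- Pointwise uniform UV stability implies the a.e. form. [folklore] -/
theorem _root_.Literature.MathematicalPhysics.QuantumLattice.BlockRGScheme.HasUniformUVStability.ae (sch : BlockRGScheme d N G) (h : sch.HasUniformUVStability) :
    sch.HasUniformUVStabilityAE := by
  obtain ⟨c, C, h⟩ := h
  exact ⟨c, C, fun k => (h k).ae sch⟩

/-- Pointwise windowed UV stability implies the a.e. form. [folklore] -/
theorem _root_.Literature.MathematicalPhysics.QuantumLattice.BlockRGScheme.HasWindowedUVStability.ae (sch : BlockRGScheme d N G) {γ : ℝ} (h : sch.HasWindowedUVStability γ) :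
    sch.HasWindowedUVStabilityAE γ := by
  obtain ⟨c, C, h⟩ := h
  exact ⟨c, C, fun k hk => (h k hk).ae sch⟩

/-- Uniform a.e. UV stability implies windowed a.e. UV stability for any window. [folklore] -/
theorem _root_.Literature.MathematicalPhysics.QuantumLattice.BlockRGScheme.HasUniformUVStabilityAE.hasWindowedUVStabilityAE (sch : BlockRGScheme d N G) (h : sch.HasUniformUVStabilityAE)
    (γ : ℝ) : sch.HasWindowedUVStabilityAE γ := by
  obtain ⟨c, C, h⟩ := h
  exact ⟨c, C, fun k _ => h k⟩

/-- Windowed a.e. UV stability is antitone in the window. [folklore] -/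
theorem _root_.Literature.MathematicalPhysics.QuantumLattice.BlockRGScheme.HasWindowedUVStabilityAE.anti (sch : BlockRGScheme d N G) {γ γ' : ℝ} (h : sch.HasWindowedUVStabilityAE γ')
    (hγ : γ ≤ γ') : sch.HasWindowedUVStabilityAE γ := by
  obtain ⟨c, C, h⟩ := h
  exact ⟨c, C, fun k hk => h k (hk.of_le hγ)⟩

/-- Vacuity check for the a.e. form (why `γ` is quantified before the scheme in
`BalabanUVStability4`): if `γ < g₀` the window condition fails at every step and windowed a.e.
UV stability holds trivially. [folklore] -/
theorem _root_.Literature.MathematicalPhysics.QuantumLattice.BlockRGScheme.hasWindowedUVStabilityAE_of_lt (sch : BlockRGScheme d N G) {γ : ℝ} (hγ : γ < sch.couplings 0) :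
    sch.HasWindowedUVStabilityAE γ :=
  ⟨0, 0, fun k hk => absurd (hk 0 (Nat.zero_le k)).2 (not_le.2 hγ)⟩

end Iterate

end BlockRGScheme
end Literature.MathematicalPhysics.QuantumFieldTheory

namespace Literature.MathematicalPhysics.QuantumFieldTheory

open QuantumLattice Literature.Probability.LatticeModels

section Balaban

/-- **constructive-qft.S20** (`d = 3` half; Bałaban, *Ultraviolet stability of three-dimensional
lattice pure gauge field theories*, CMP 102 (1985) 255–275, Thm. 1). Three-dimensional lattice
pure `SU(2)` gauge theory in the fundamental (Wilson) representation, at coupling `g > 0` and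
block size `M ≥ 2`, considered for every ultraviolet cutoff `ε = M⁻ⁿ`, `n ∈ ℕ`, with Bałaban's
bare coupling `g_ε² = g² ε` (CMP 102 §0; `d = 3` is super-renormalisable, no smallness of `g` is
assumed): there are, for every cutoff level `n`, free-energy (vacuum-energy) normalisations
`E^{(n)}_k(Λ)` and normalised block RG iterates `ρ^{(n)}_k` of the Wilson density
`ρ^{(n)}_0 = exp (-g_ε⁻² S_Λ)`, and constants `c, C` *independent of the cutoff* `n`, such that
the effective density on the unit lattice (after `n` steps) obeys
`e^{-c|Λ|} ≤ ρ^{(n)}_n(Λ, V) ≤ e^{C|Λ|}` for every finite coarse volume `Λ` and Haar-a.e. `V`.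

Quantifier shape: universal in the free data `M, g`, existential in the cutoff-indexed family
of schemes `sch n`, the normalisations and the constants, universal in `n` — Bałaban's theorem
asserts the *existence* of counterterms together with bounds uniform in the lattice spacing.
The family is pinned: `(sch n).effDensity 0` is the Wilson density at bare coupling
`g² M⁻ⁿ` (`effDensity_zero`, A18, and the conjunct on `(sch n).couplings 0`), and
`IsRGIterateWith (E n)` determines the iterates Haar-a.e. up to the positive constants
`e^{E_k(Λ)}` (a constant factor cannot help two-sided bounds beyond `O(1)`), so the conclusion is
a claim about the essential oscillation of the `n`-fold block RG transform of the Wilson density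
at coupling `g² M⁻ⁿ`, uniformly in `n`. The elementary Haar-invariance bound (see
`BlockRGScheme.HasUniformUVStability`) gives only `K ~ g⁻² Mⁿ`, so uniformity in `n` is
exactly the non-trivial content of CMP 102 (review r02500B). Bounds at intermediate scales
`j < n` are omitted (Bałaban's lower bound there carries the main term `-g_j⁻² A_j(V)` with the
small effective coupling `g_j² = g² M^{j-n}` and is not of two-sided `e^{∓c|Λ|}` form); the
constants may depend on `M, g` (in Bałaban on `g, M` and `G` only, likewise). Schemes with
`IsRGIterateWith E` exist (take for `ρ_{k+1}(Λ, ·)` a version of the Radon–Nikodym derivative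
of the pushed-forward measure, absolutely continuous because block holonomies of distinct coarse
edges are products of disjoint families of Haar variables), so the proposition is not vacuous;
mass check: with `Λ`-dependent normalisations the recursion imposes no relation between total
masses (see `BlockRGScheme.IsRGIterateWith`).

*Schematic* over the hypothesis structure `BlockRGScheme` (prelude A18), whose `effDensity` is
`STUB(v0)`: the recursion is imposed here only in the simplified free-boundary axial-gauge form
`IsRGIterateWith` (no small/large-field split, free instead of periodic boundary condition,
straight-line instead of gauge-covariantly averaged block holonomies), and it determines the
iterates only Haar-a.e., whence the a.e. conclusion `HasUVStabilityBoundsAtAE`. Modulo these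
flagged simplifications this is a transcription of CMP 102 Thm. 1; it is **not asserted**. [folklore] -/
def BalabanUVStability3 : Prop :=
  ∀ (M : ℕ) (g : ℝ), 2 ≤ M → 0 < g →
    ∃ (sch : ℕ → BlockRGScheme 3 2 (Matrix.specialUnitaryGroup (Fin 2) ℂ))
      (E : ℕ → ℕ → Finset (ZdEdge 3) → ℝ) (c C : ℝ), ∀ n : ℕ,
      (sch n).M = M ∧ (sch n).ρ = fundamentalRep (Fin 2) ∧
        0 < (sch n).couplings 0 ∧ (sch n).couplings 0 ^ 2 = g ^ 2 * ((M : ℝ) ^ n)⁻¹ ∧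
        (sch n).IsRGIterateWith (E n) ∧ (sch n).HasUVStabilityBoundsAtAE c C n

/-- **constructive-qft.S20** (`d = 4` half; Bałaban, *Large field renormalization. II*, CMP 122
(1989) 355–392, Thm. 1; *Convergent renormalization expansions for lattice gauge theories*,
CMP 119 (1988) 243–285, Thm. 1 (p. 262) and Cor. 3 "Ultraviolet Stability" (p. 264);
*Renormalization group approach to lattice gauge field theories. I*, CMP 109 (1987) 249–301,
Thm. 2, (0.3), (0.18), (0.20), (0.33)), recorded as a **predicate** in the window `γ` and the
cutoff-indexed family of running couplings `gs : ℕ → RunningCouplings` (`gs n` = the couplings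
at cutoff `ε = M⁻ⁿ`: bare coupling `gs n 0 = g_ε`, renormalised unit-scale coupling `gs n n`).
It says: for four-dimensional lattice pure `SU(2)` gauge theory in the fundamental (Wilson)
representation, every block size `M ≥ 2` and every renormalised coupling `0 < g ≤ γ` with
`gs n n = g` and `0 < (gs n)_j ≤ γ` for all `j ≤ n` (`InWindow`), there are normalisations
`E^{(n)}_k(Λ)`, normalised block RG iterates `ρ^{(n)}_k` of the Wilson density at bare coupling
`gs n 0` (`IsRGIterateWith`) and constants `c, C` independent of `n` with
`e^{-c|Λ|} ≤ ρ^{(n)}_n(Λ, V) ≤ e^{C|Λ|}` on the unit lattice, for every finite `Λ` and Haar-a.e.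
`V` — the `d = 4` analogue of `BalabanUVStability3` (same family shape, same omission of
intermediate scales, constants allowed to depend on `M, g, gs`; Bałaban's depend on the window
and on `g_k`, CMP 119 Cor. 3).

Why a predicate in `(γ, gs)` and not a closed proposition (verdict clean-up 2026-08-15; outline
R5/R6). In Bałaban's theorem the couplings are not data: CMP 119 Thm. 1 (p. 262) is stated for
"the sequence of coupling constants `{g_k}`, determined by the recursive renormalization group
(Callan–Symanzik) equations (0.18), (0.20) [CMP 109]" subject to the inequalities (0.33) of
CMP 109 (the window), in `d = 4` "the bare coupling constant behaves asymptotically as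
`(a + b log ε⁻¹)^{-1/2}`, for `ε → 0`" (CMP 119 p. 244: asymptotic freedom, versus `g₀ = g ε^{1/2}`
in `d = 3`), and the stability constants are "independent of `η` and `T`" (cutoff and torus)
"but depending on `g_k`" (CMP 119 Cor. 3, p. 264). Over the hypothesis structure `BlockRGScheme`
(prelude A18) none of this is expressible: `couplings` is free data decoupled from the
`STUB(v0)` `effDensity`, and the recursion imposed here, `IsRGIterateWith`, has no coupling
renormalisation (nor small/large-field split, nor `R`-operation), so that only the bare coupling
`gs n 0` enters, through `effDensity_zero`. Consequently:
* the former closed rendering of this file quantified *universally* over the families `gs` in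
  the window — up to the order of the universal quantifiers it read
  `∃ γ > 0, ∀ gs, BalabanUVStability4 γ gs` — and that closure is refutable as rendered: for bare
  couplings `gs n 0 = γ εₙ` with `εₙ ↓ 0` fast enough, the Wilson measure on `fineEdgesⁿ {b}`
  (glued to `1` outside, `freeHaarConfig`; the boundary Wilson action of such a configuration
  vanishes only at `U = 1`) concentrates at `U = 1` as `n → ∞`, hence the `n`-th iterate of the
  `n`-th scheme on `Λ = {b}` — up to its normalisation the law of an ordered product of `Mⁿ`
  fine links — concentrates at `V = 1`, contradicting `n`-uniform two-sided a.e. bounds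
  (informal refutation by the previous proving seat, not kernel-checked);
* the closure `∃ gs` carries none of Bałaban's content: with constant couplings `gs n = g` the
  `n`-th iterate of the `n`-th scheme is the `n`-th iterate of one fixed scheme, for which
  `k`-uniform bounds are the elementary Haar-invariance estimate
  `BlockRGScheme.haarIterate_hasUniformUVStability` (file `QuantumLattice/BalabanRGHaarIterates`,
  constant `∝ g⁻²`).
Bałaban's theorem is the instance of the predicate at the RG-determined family (and at Bałaban's
`R`-renormalised densities), which v0 does not define; like its single-scheme form
`BlockRGScheme.HasWindowedUVStabilityAE`, the proposition is a *schematic* predicate and is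
**not asserted** for any particular `gs`. The window hypothesis is on the parameter `gs`, so it
cannot be dodged by the existential witness `sch` (whose couplings are pinned to `gs n`).
[folklore] -/
def BalabanUVStability4 (γ : ℝ) (gs : ℕ → RunningCouplings) : Prop :=
  ∀ (M : ℕ) (g : ℝ), 2 ≤ M → 0 < g → g ≤ γ → (∀ n, gs n n = g ∧ InWindow (gs n) γ n) →
    ∃ (sch : ℕ → BlockRGScheme 4 2 (Matrix.specialUnitaryGroup (Fin 2) ℂ))
      (E : ℕ → ℕ → Finset (ZdEdge 4) → ℝ) (c C : ℝ), ∀ n : ℕ,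
      (sch n).M = M ∧ (sch n).ρ = fundamentalRep (Fin 2) ∧ (sch n).couplings = gs n ∧
        (sch n).IsRGIterateWith (E n) ∧ (sch n).HasUVStabilityBoundsAtAE c C n

end Balaban

/-! ### constructive-qft.S21: continuum `SU(2)` Yang–Mills in finite volume (MRS 1993) -/

section MRS

open scoped Matrix.Norms.Frobenius

/-! #### General vocabulary: axial gauge, localised action, `𝔰𝔲(N)` -/

section General

variable {E : Type*} [NormedAddCommGroup E] [InnerProductSpace ℝ E]
variable {𝔸 : Type*} [NormedRing 𝔸] [NormedAlgebra ℝ 𝔸]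

/-- The **axial gauge** condition with respect to the direction `n`: `A(x)(n) = 0` for all `x`
(`n · A = 0`; MRS CMP 155 (1993) §1, axial gauge `A₀ = 0`; W. Kummer, Acta Phys. Austriaca 41
(1975)). Stated for A14 `Connection E 𝔸`. [folklore] -/
def IsAxialGauge (n : E) (A : Connection E 𝔸) : Prop :=
  ∀ x : E, A x n = 0

/-- The zero connection is in axial gauge. [folklore] -/
@[simp] theorem isAxialGauge_zero (n : E) : IsAxialGauge n (0 : Connection E 𝔸) :=
  fun _ => rfl

/-- A residual gauge parameter for the axial gauge in direction `n`: `ω` is constant along `n`,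
`ω (x + t • n) = ω x` (then `D_n ω = ∂_n ω + [A_n, ω] = 0` in axial gauge, so `δA = D ω`
preserves `A(n) = 0`; Kummer 1975 §2). [cite: Kummer1975, §2] -/
def IsAxialResidual (n : E) (ω : E → 𝔸) : Prop :=
  ∀ (x : E) (t : ℝ), ω (x + t • n) = ω x

variable [FiniteDimensional ℝ E]

/-- The **mass density** `|A(x)|² = ∑_μ ‖A(x)(e_μ)‖²` of a connection in the standard
orthonormal frame `e = stdOrthonormalBasis ℝ E` (the integrand of the gauge-field mass
counterterm `∫ tr A_μ A_μ` of MRS CMP 155 (1993) §1; companion of A14 `ymDensity`). [folklore] -/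
def massDensity (A : Connection E 𝔸) (x : E) : ℝ :=
  ∑ i, ‖A x (stdOrthonormalBasis ℝ E i)‖ ^ 2

/-- The mass density is nonnegative. [folklore] -/
theorem massDensity_nonneg (A : Connection E 𝔸) (x : E) : 0 ≤ massDensity A x :=
  Finset.sum_nonneg fun _ _ => by positivity

/-- The mass density of the zero connection vanishes. [folklore] -/
@[simp] theorem massDensity_zero (x : E) : massDensity (0 : Connection E 𝔸) x = 0 := by
  simp [massDensity]

variable [MeasurableSpace E] [BorelSpace E]

/-- The Yang–Mills action **localised in the volume `Λ`**: `S_Λ(A) = ∫_Λ |F_A(x)|² dx`, with A14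
`ymDensity` (Jaffe–Witten (2000) §1; MRS CMP 155 (1993) (1.1) with infrared cutoff `Λ`). For
`Λ = univ` this is A14 `ymAction`. Junk value `0` if the density is not integrable on `Λ`. [cite: JaffeWitten2000] -/
def ymActionOn (Λ : Set E) (A : Connection E 𝔸) : ℝ :=
  ∫ x in Λ, ymDensity A x

/-- The localised action over the whole space is the Yang–Mills action. [folklore] -/
@[simp] theorem ymActionOn_univ (A : Connection E 𝔸) : ymActionOn Set.univ A = ymAction A := by
  simp [ymActionOn, ymAction]

/-- The localised Yang–Mills action is nonnegative (Jaffe–Witten (2000) §1). [cite: JaffeWitten2000] -/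
theorem ymActionOn_nonneg (Λ : Set E) (A : Connection E 𝔸) : 0 ≤ ymActionOn Λ A :=
  integral_nonneg fun x => ymDensity_nonneg A x

/-- The **local counterterm functional** in the volume `Λ` with mass coefficient `a` and
field-strength (coupling / wave-function) coefficient `b`:
`δS_Λ(A) = ∫_Λ (a |A(x)|² + b |F_A(x)|²) dx` (MRS CMP 155 (1993) §1: the counterterms of the
regularised axial gauge are a gauge-field mass term and a coupling-constant renormalisation,
fixed by the Slavnov identities). Junk value `0` if not integrable on `Λ`. [folklore] -/
def localCounterterm (Λ : Set E) (a b : ℝ) (A : Connection E 𝔸) : ℝ :=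
  ∫ x in Λ, (a * massDensity A x + b * ymDensity A x)

/-- With vanishing coefficients the local counterterm vanishes. [folklore] -/
@[simp] theorem localCounterterm_zero_zero (Λ : Set E) (A : Connection E 𝔸) :
    localCounterterm Λ 0 0 A = 0 := by
  simp [localCounterterm]

end General

/-- The real Lie algebra `𝔰𝔲(N) ⊆ M_N(ℂ)` of traceless skew-Hermitian matrices, as an
`ℝ`-submodule: `skewAdjoint.submodule ℝ M_N(ℂ) ⊓ ker (Re-linear trace)` (Bröcker–tom Dieck I
(2.18); Mathlib `skewAdjoint.submodule`, `Matrix.traceLinearMap`). Used through A14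
`Connection.IsValuedIn`. [folklore] -/
def suAlgebra (N : ℕ) : Submodule ℝ (Matrix (Fin N) (Fin N) ℂ) :=
  skewAdjoint.submodule ℝ (Matrix (Fin N) (Fin N) ℂ) ⊓
    LinearMap.ker (Matrix.traceLinearMap (Fin N) ℝ ℂ)

/-- Membership in `𝔰𝔲(N)`: skew-Hermitian and traceless. [folklore] -/
theorem mem_suAlgebra_iff {N : ℕ} (X : Matrix (Fin N) (Fin N) ℂ) :
    X ∈ suAlgebra N ↔ X.conjTranspose = -X ∧ X.trace = 0 := by
  simp [suAlgebra, skewAdjoint.submodule, skewAdjoint.mem_iff, Matrix.star_eq_conjTranspose,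
    Submodule.mem_inf]

/-! #### Gauge-field Schwinger functions on `ℝ⁴` -/

/-- Index of a component of the `SU(2)` gauge field `A_μ(x) ∈ 𝔰𝔲(2) ⊆ M₂(ℂ)`: a Euclidean
direction `μ : Fin 4` and a matrix entry `(p, q) : Fin 2 × Fin 2` (basis-free substitute for a
colour index `a = 1, 2, 3`; MRS CMP 155 (1993) §1). Note that for `𝔰𝔲(2)`-valued fields the four
entries are *not* independent (`A_{11} = -A_{22}`, `A_{21} = -conj A_{12}`): the matrix-entry
Schwinger functions are a redundant but complete set of components. [folklore] -/
abbrev GaugeFieldIndex : Type := Fin 4 × Fin 2 × Fin 2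

/-- The component `(A_μ(x))_{pq} ∈ ℂ` of a classical `M₂(ℂ)`-valued connection on `ℝ⁴` (A14
`Connection`) labelled by `ι = (μ, p, q)`, with `e_μ = EuclideanSpace.single μ 1`. [folklore] -/
def gaugeFieldComponent (ι : GaugeFieldIndex)
    (A : Connection (EuclideanSpace ℝ (Fin 4)) (Matrix (Fin 2) (Fin 2) ℂ))
    (x : EuclideanSpace ℝ (Fin 4)) : ℂ :=
  A x (EuclideanSpace.single ι.1 1) ι.2.1 ι.2.2

/-- The **gauge-field Schwinger functions** of `SU(2)` Yang–Mills on `ℝ⁴`: for each `n` and each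
choice of component indices `ι : Fin n → GaugeFieldIndex`, a tempered distribution
`𝔖ₙ^ι ∈ 𝒮'((ℝ⁴)ⁿ)`, formally `𝔖ₙ^ι(x₁, …, xₙ) = ⟨∏ᵢ (A_{μᵢ}(xᵢ))_{pᵢqᵢ}⟩` (MRS CMP 155 (1993)
Thm. 1: "the Schwinger functions"; OS 1973 §3). For fixed indices `fun n => S n (ι n)` is an A3
`SchwingerFamily (EuclideanSpace ℝ (Fin 4))`. [cite: OS1973, §3] -/
abbrev YMSchwingerFamily : Type :=
  (n : ℕ) → (Fin n → GaugeFieldIndex) →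
    (𝓢((Fin n → EuclideanSpace ℝ (Fin 4)), ℂ) →L[ℂ] ℂ)

/-- The Schwinger family (A3 `SchwingerFamily`) of a gauge-field Schwinger family at a fixed
sequence of component indices. [folklore] -/
def YMSchwingerFamily.component (S : YMSchwingerFamily) (ι : (n : ℕ) → Fin n → GaugeFieldIndex) :
    SchwingerFamily (EuclideanSpace ℝ (Fin 4)) :=
  fun n => S n (ι n)

/-- The smeared field monomial `∫ F(x₁, …, xₙ) ∏ᵢ (A_{μᵢ}(xᵢ))_{pᵢqᵢ} dx` of a classical
connection `A`, whose expectation under a regularised law is the regularised Schwinger function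
(MRS CMP 155 (1993) §1; GJ §6.1). Junk value `0` if not integrable (never the case for continuous
polynomially bounded `A`). [folklore] -/
def fieldMonomial (n : ℕ) (ι : Fin n → GaugeFieldIndex)
    (F : 𝓢((Fin n → EuclideanSpace ℝ (Fin 4)), ℂ))
    (A : Connection (EuclideanSpace ℝ (Fin 4)) (Matrix (Fin 2) (Fin 2) ℂ)) : ℂ :=
  ∫ x : Fin n → EuclideanSpace ℝ (Fin 4), F x * ∏ i, gaugeFieldComponent (ι i) A (x i)

/-! #### The configuration space: smooth `𝔰𝔲(2)`-valued axial-gauge connections -/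

/-- The axial (Euclidean time) direction `e₀ = EuclideanSpace.single 0 1 ∈ ℝ⁴` of the axial
gauge `A₀ = 0` (MRS CMP 155 (1993) §1). [folklore] -/
def axialDirection : EuclideanSpace ℝ (Fin 4) :=
  EuclideanSpace.single (0 : Fin 4) (1 : ℝ)

/-- The axial direction is the unit vector `e₀`. [folklore] -/
@[simp] theorem axialDirection_apply (i : Fin 4) :
    axialDirection i = if i = 0 then 1 else 0 := by
  simp [axialDirection]

/-- The **configuration space of regularised axial-gauge `SU(2)` Yang–Mills** on the trivial
bundle over `ℝ⁴`: smooth (A14 `IsSmoothConnection`), `𝔰𝔲(2)`-valued (A14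
`Connection.IsValuedIn (suAlgebra 2)`) classical connections `A : Connection ℝ⁴ M₂(ℂ)` in axial
gauge `A(x) e₀ = 0` (`IsAxialGauge axialDirection`) (MRS CMP 155 (1993) §1). The constraints
are built into the carrier (a subtype) rather than imposed almost everywhere: on the raw
product type `ℝ⁴ → (ℝ⁴ →L[ℝ] M₂(ℂ))` with `MeasurableSpace.pi` every measurable set depends on
countably many points only, so no non-zero measure is a.e. carried by axial (or smooth)
connections (review r01907B, `Probe.exists_countable_dependsOn`). The σ-algebra is the subtype
(cylinder) σ-algebra generated by the field values `A ↦ A(x)`, `x ∈ ℝ⁴`; on smooth connections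
it separates points (`AxialConfig.instMeasurableSingletonClass`). [folklore] -/
def AxialConfig : Type _ :=
  {A : Connection (EuclideanSpace ℝ (Fin 4)) (Matrix (Fin 2) (Fin 2) ℂ) //
    IsSmoothConnection A ∧ A.IsValuedIn (suAlgebra 2) ∧ IsAxialGauge axialDirection A}

namespace AxialConfig

/-- The cylinder σ-algebra on axial configurations: the subtype σ-algebra of the product
σ-algebra of the field values (Mathlib `Subtype.instMeasurableSpace`, `MeasurableSpace.pi`,
`ContinuousLinearMap.instMeasurableSpace`). [folklore] -/
instance instMeasurableSpace : MeasurableSpace AxialConfig := Subtype.instMeasurableSpace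

/-- The underlying classical connection of an axial configuration. [folklore] -/
instance instCoeFun : CoeFun AxialConfig
    (fun _ => EuclideanSpace ℝ (Fin 4) → EuclideanSpace ℝ (Fin 4) →L[ℝ] Matrix (Fin 2) (Fin 2) ℂ) :=
  ⟨Subtype.val⟩

/-- The zero connection is a smooth `𝔰𝔲(2)`-valued axial configuration. [folklore] -/
instance instZero : Zero AxialConfig :=
  ⟨⟨0, contDiff_const, fun _ _ => Submodule.zero_mem _, isAxialGauge_zero _⟩⟩

/-- `AxialConfig` is inhabited (by the zero connection). [folklore] -/
instance instInhabited : Inhabited AxialConfig := ⟨0⟩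

/-- The zero configuration is the zero connection. [folklore] -/
@[simp] theorem coe_zero : ((0 : AxialConfig) : Connection (EuclideanSpace ℝ (Fin 4))
    (Matrix (Fin 2) (Fin 2) ℂ)) = 0 := rfl

/-- Two axial configurations with the same underlying connection are equal. [folklore] -/
@[ext] theorem ext {A B : AxialConfig}
    (h : (A : Connection (EuclideanSpace ℝ (Fin 4)) (Matrix (Fin 2) (Fin 2) ℂ)) = B) : A = B :=
  Subtype.ext h

/-- Axial configurations are smooth connections. [folklore] -/
theorem isSmoothConnection (A : AxialConfig) :
    IsSmoothConnection (A : Connection (EuclideanSpace ℝ (Fin 4)) (Matrix (Fin 2) (Fin 2) ℂ)) :=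
  A.2.1

/-- Axial configurations are `𝔰𝔲(2)`-valued. [folklore] -/
theorem isValuedIn (A : AxialConfig) :
    Connection.IsValuedIn (suAlgebra 2)
      (A : Connection (EuclideanSpace ℝ (Fin 4)) (Matrix (Fin 2) (Fin 2) ℂ)) :=
  A.2.2.1

/-- Axial configurations are in axial gauge, `A(x) e₀ = 0`. [folklore] -/
theorem isAxialGauge (A : AxialConfig) :
    IsAxialGauge axialDirection
      (A : Connection (EuclideanSpace ℝ (Fin 4)) (Matrix (Fin 2) (Fin 2) ℂ)) :=
  A.2.2.2

/-- Axial configurations are continuous connections. [folklore] -/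
theorem continuous (A : AxialConfig) :
    Continuous (A : Connection (EuclideanSpace ℝ (Fin 4)) (Matrix (Fin 2) (Fin 2) ℂ)) :=
  A.isSmoothConnection.continuous

/-- The inclusion into classical connections is measurable (by definition of the cylinder
σ-algebra). [folklore] -/
theorem measurable_coe : Measurable (fun A : AxialConfig =>
    (A : Connection (EuclideanSpace ℝ (Fin 4)) (Matrix (Fin 2) (Fin 2) ℂ))) :=
  measurable_subtype_coe

/-- The field values `A ↦ A(x)` are measurable. [folklore] -/
theorem measurable_apply (x : EuclideanSpace ℝ (Fin 4)) :
    Measurable (fun A : AxialConfig => (A : Connection (EuclideanSpace ℝ (Fin 4))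
      (Matrix (Fin 2) (Fin 2) ℂ)) x) :=
  (measurable_pi_apply x).comp measurable_coe

/-- Singletons are measurable for the cylinder σ-algebra on axial configurations: a continuous
connection is determined by its values on a countable dense subset of `ℝ⁴`. Hence
`NullSingletonClass` (used in `AxialGaugeYMRegularisation.nullSingleton_ref`) is a genuine
atomlessness condition on this carrier. [folklore] -/
instance instMeasurableSingletonClass : MeasurableSingletonClass AxialConfig where
  measurableSet_singleton A₀ := by
    obtain ⟨D, hDc, hDd⟩ := TopologicalSpace.exists_countable_dense (EuclideanSpace ℝ (Fin 4))
    have hEq : ({A₀} : Set AxialConfig) =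
        ⋂ q ∈ D, {A : AxialConfig | (A : Connection (EuclideanSpace ℝ (Fin 4))
          (Matrix (Fin 2) (Fin 2) ℂ)) q = A₀ q} := by
      ext A
      simp only [Set.mem_singleton_iff, Set.mem_iInter, Set.mem_setOf_eq]
      refine ⟨fun h _ _ => h ▸ rfl, fun h => ?_⟩
      exact AxialConfig.ext
        (Continuous.ext_on hDd A.continuous A₀.continuous fun q hq => h q hq)
    rw [hEq]
    exact MeasurableSet.biInter hDc fun q _ => measurable_apply q (measurableSet_singleton _)

end AxialConfig

/-! #### Regularised axial-gauge Yang–Mills laws (hypothesis structure) -/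

/-- **Regularised axial-gauge `SU(2)` Yang–Mills data** in the finite volume `Λ ⊆ ℝ⁴` at
renormalised coupling `g` (hypothesis structure; *schematic*). MRS CMP 155 (1993) Thm. 1 and §1:
"the Schwinger functions of continuum `SU(2)` `YM₄` in finite volume (fixed IR cutoff),
regularised axial gauge, trivial topological sector, are constructed as limits of UV-regularised
functional integrals with a convergent expansion and bounds uniform in the UV cutoff". The data:
for each UV cutoff index `κ : ℕ` a reference measure `ref κ` on the configuration space
`AxialConfig` of smooth `𝔰𝔲(2)`-valued axial-gauge connections of the trivial bundle (A14
`Connection ℝ⁴ M₂(ℂ)`; the regularised axial-gauge Gaussian/flat measure) and the coefficients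
`massCT κ`, `fieldCT κ` of the *local* counterterms
`δS_κ(A) = ∫_Λ (massCT κ |A|² + fieldCT κ |F_A|²)` (`localCounterterm`; MRS §1: a gauge-field
mass counterterm and the coupling-constant renormalisation, the latter nonnegative by
asymptotic freedom, `g_bare⁻² = g⁻² + fieldCT κ ≥ g⁻²`); the regularised law is the Gibbs
measure `law κ = exp (-(g⁻² S_Λ(A) + δS_κ(A))) d(ref κ) / Z` (Mathlib `Measure.tilted`, A14
`ymDensity` via `ymActionOn`).

Imposed: the laws are probability measures on `AxialConfig` (smoothness, `𝔰𝔲(2)`-valuedness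
and the axial gauge are built into the carrier), with atomless reference measures
(`nullSingleton_ref`; meaningful by `AxialConfig.instMeasurableSingletonClass`; it excludes
Dirac-type references such as `½(δ₀ + δ_{A_κ})`); the counterterms are local of the above form
with `0 ≤ fieldCT κ` (so the total coefficient of `S_Λ` is `≥ g⁻² > 0` and cannot be absorbed:
`g` and `Λ` enter the laws non-trivially); and the cutoff is genuinely removed,
`𝔼_{ref κ}[S_Λ] → ∞` as `κ → ∞` (`tendsto_action`; for the free Gaussian measure with momentum
cutoff `κ` one has `𝔼[∫_Λ |F_A|²] ~ κ⁴ |Λ|`), which rules out cutoff-independent reference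
measures and volumes `Λ` of measure zero. NOT imposed (schematic): that `ref κ` *is* the
axial-gauge Gaussian measure with cutoff `κ` (Mathlib has no Gaussian measures on such spaces
at the pin), MRS's positivity-restoring regularisation and large-field treatment.

Witnesses of the structure (informal): finite-mode Gaussian reference measures, i.e. the
pushforward of the standard Gaussian on `ℝ^{m_κ}` under `ξ ↦ ∑_{j < m_κ} ξ_j h_j` for fixed
linearly independent smooth compactly supported `𝔰𝔲(2)`-valued axial modes `h_j` with
`m_κ → ∞` modes supported in `Λ` (the map is measurable for the cylinder σ-algebra since each
field value is linear in `ξ`; it is injective, so singletons are null; the expected action grows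
like `m_κ`; the Boltzmann weight is bounded for `massCT κ ≥ 0`). Consequently artificial
witnesses unrelated to Yang–Mills theory are not excluded; see `MagnenRivasseauSeneorYM4`. [folklore] -/
structure AxialGaugeYMRegularisation (Λ : Set (EuclideanSpace ℝ (Fin 4))) (g : ℝ) where
  /-- The UV-regularised reference measures on axial configurations, one per cutoff index `κ`
  (MRS CMP 155 (1993) §1). -/
  ref : ℕ → Measure AxialConfig
  /-- The mass counterterm coefficient at cutoff `κ` (MRS CMP 155 (1993) §1). -/
  massCT : ℕ → ℝ
  /-- The field-strength (coupling-constant) counterterm coefficient at cutoff `κ`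
  (MRS CMP 155 (1993) §1: fixed by the Slavnov identities). -/
  fieldCT : ℕ → ℝ
  /-- Asymptotic freedom: the bare inverse coupling `g⁻² + fieldCT κ` is at least `g⁻²`. -/
  fieldCT_nonneg : ∀ κ, 0 ≤ fieldCT κ
  /-- The reference measures charge no single configuration (Gaussian reference measures with
  at least one non-degenerate mode have no atoms; Mathlib `NullSingletonClass`; singletons are
  measurable by `AxialConfig.instMeasurableSingletonClass`). This excludes Dirac-type references
  such as `½(δ₀ + δ_{A_κ})`, which would otherwise produce the trivial Schwinger family as a
  "UV limit". -/
  nullSingleton_ref : ∀ κ, NullSingletonClass (ref κ)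
  /-- The UV cutoff is removed as `κ → ∞`: the expected localised Yang–Mills action under the
  reference measure diverges (MRS CMP 155 (1993) §1, "as the ultraviolet cutoff is removed").
  Junk-value caveat: both integrals are Bochner integrals, so `∫ S_Λ d(ref κ)` is `0` when
  `ymActionOn Λ` is not `ref κ`-integrable (harmless: divergence forces eventual integrability),
  and `ymActionOn Λ A` itself is `0` when `ymDensity A` is not integrable on `Λ` (for smooth `A`
  and bounded `Λ` this does not happen). -/
  tendsto_action : Tendsto (fun κ => ∫ A : AxialConfig, ymActionOn Λ
    (A : Connection (EuclideanSpace ℝ (Fin 4)) (Matrix (Fin 2) (Fin 2) ℂ)) ∂(ref κ)) atTop atTop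
  /-- The Gibbs measures `exp (-(g⁻² S_Λ + δS_κ)) d(ref κ) / Z` are probability measures
  (i.e. `ref κ ≠ 0` and the Boltzmann weight is `ref κ`-integrable). -/
  isProbabilityMeasure_tilted : ∀ κ, IsProbabilityMeasure
    ((ref κ).tilted fun A : AxialConfig =>
      -((g ^ 2)⁻¹ * ymActionOn Λ
          (A : Connection (EuclideanSpace ℝ (Fin 4)) (Matrix (Fin 2) (Fin 2) ℂ)) +
        localCounterterm Λ (massCT κ) (fieldCT κ)
          (A : Connection (EuclideanSpace ℝ (Fin 4)) (Matrix (Fin 2) (Fin 2) ℂ))))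

namespace AxialGaugeYMRegularisation

variable {Λ : Set (EuclideanSpace ℝ (Fin 4))} {g : ℝ} (D : AxialGaugeYMRegularisation Λ g)

/-- The counterterm functional at cutoff `κ`: `δS_κ = localCounterterm Λ (massCT κ) (fieldCT κ)`
evaluated on the underlying connection (MRS CMP 155 (1993) §1). [folklore] -/
def counterterm (κ : ℕ) (A : AxialConfig) : ℝ :=
  localCounterterm Λ (D.massCT κ) (D.fieldCT κ)
    (A : Connection (EuclideanSpace ℝ (Fin 4)) (Matrix (Fin 2) (Fin 2) ℂ))

/-- The counterterm of the zero configuration vanishes. [folklore] -/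
@[simp] theorem counterterm_zero (κ : ℕ) : D.counterterm κ 0 = 0 := by
  simp [counterterm, localCounterterm, ymDensity, ymDensityOfBasis, curvature, Ring.lie_def]

/-- The regularised axial-gauge Yang–Mills law at cutoff `κ`:
`exp (-(g⁻² S_Λ(A) + δS_κ(A))) d(ref κ) / Z` on `AxialConfig` (MRS CMP 155 (1993) §1; Mathlib
`Measure.tilted`). [folklore] -/
def law (κ : ℕ) : Measure AxialConfig :=
  (D.ref κ).tilted fun A => -((g ^ 2)⁻¹ * ymActionOn Λ
    (A : Connection (EuclideanSpace ℝ (Fin 4)) (Matrix (Fin 2) (Fin 2) ℂ)) + D.counterterm κ A)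

/-- The reference measures are non-zero (a tilt of the zero measure is not a probability
measure). [folklore] -/
theorem ref_ne_zero (κ : ℕ) : D.ref κ ≠ 0 := by
  intro h
  have := D.isProbabilityMeasure_tilted κ
  rw [h, tilted_zero_measure] at this
  exact (IsProbabilityMeasure.ne_zero (0 : Measure AxialConfig)) rfl

/-- The regularised laws are probability measures. [folklore] -/
instance isProbabilityMeasure_law (κ : ℕ) : IsProbabilityMeasure (D.law κ) :=
  D.isProbabilityMeasure_tilted κ

/-- The regularised laws charge no single configuration (absolute continuity of
`Measure.tilted`). [folklore] -/
instance nullSingletonClass_law (κ : ℕ) : NullSingletonClass (D.law κ) where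
  measure_singleton A := by
    have := D.nullSingleton_ref κ
    exact tilted_absolutelyContinuous _ _ (measure_singleton A)

/-- The regularised Schwinger function at cutoff `κ`: the expectation of the smeared field
monomial under `law κ` (MRS CMP 155 (1993) Thm. 1). [folklore] -/
def schwinger (κ n : ℕ) (ι : Fin n → GaugeFieldIndex)
    (F : 𝓢((Fin n → EuclideanSpace ℝ (Fin 4)), ℂ)) : ℂ :=
  ∫ A : AxialConfig, fieldMonomial n ι F
    (A : Connection (EuclideanSpace ℝ (Fin 4)) (Matrix (Fin 2) (Fin 2) ℂ)) ∂(D.law κ)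

/-- `S` is the **UV limit** of the regularised Schwinger functions of `D`: every field monomial
is integrable at every cutoff and the regularised Schwinger functions converge to `S` as the
cutoff is removed, `κ → ∞` (MRS CMP 155 (1993) Thm. 1: "bounds uniform in the ultraviolet
cutoff", existence of the limit). The `Integrable` conjunct includes a.e.-strong measurability
of `A ↦ fieldMonomial n ι F A` for the cylinder σ-algebra of `AxialConfig` — a genuine (true,
not transcribed) condition: for continuous `A` the smeared monomial is a limit of Riemann sums
of products of field values, each measurable by `AxialConfig.measurable_apply`. [folklore] -/
def HasUVLimit (S : YMSchwingerFamily) : Prop :=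
  ∀ (n : ℕ) (ι : Fin n → GaugeFieldIndex) (F : 𝓢((Fin n → EuclideanSpace ℝ (Fin 4)), ℂ)),
    (∀ κ, Integrable (fun A : AxialConfig => fieldMonomial n ι F
      (A : Connection (EuclideanSpace ℝ (Fin 4)) (Matrix (Fin 2) (Fin 2) ℂ))) (D.law κ)) ∧
      Tendsto (fun κ => D.schwinger κ n ι F) atTop (𝓝 (S n ι F))

/-- The UV limit of the regularised Schwinger functions, if it exists, is unique. [folklore] -/
theorem HasUVLimit.unique {S S' : YMSchwingerFamily} (h : D.HasUVLimit S)
    (h' : D.HasUVLimit S') : S = S' := by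
  funext n ι
  ext F
  exact tendsto_nhds_unique (h n ι F).2 (h' n ι F).2

end AxialGaugeYMRegularisation

/-- `S` is a **regularised-axial-gauge Yang–Mills limit** in the volume `Λ` at coupling `g`: it is
the UV limit of the Schwinger functions of some regularised axial-gauge `SU(2)` Yang–Mills data
(`AxialGaugeYMRegularisation`, rendered through A14 `Connection`/`ymDensity` on the carrier
`AxialConfig`). *Schematic*: MRS CMP 155 (1993) Thm. 1, "we construct the Schwinger functions of
`SU(2)` `YM₄` with an infrared cutoff, in the regularised axial gauge and trivial topological
sector, for small renormalised coupling; the expansion converges and the bounds are uniform in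
the UV cutoff". What the predicate constrains: `Λ` enters through the localised action `S_Λ`
(total coefficient `≥ g⁻²`) and through the divergence `𝔼_{ref κ}[S_Λ] → ∞` (so `Λ` has
positive measure), `g` through the Gibbs weight; what it does not constrain: which
regularisation `ref κ` is used (existentially quantified data). [folklore] -/
def IsRegularisedAxialGaugeYMLimit (Λ : Set (EuclideanSpace ℝ (Fin 4))) (g : ℝ)
    (S : YMSchwingerFamily) : Prop :=
  ∃ D : AxialGaugeYMRegularisation Λ g, D.HasUVLimit S

/-! #### Slavnov (residual Ward) identities -/

/-- Witness predicate: `G` is obtained from the `(n+1)`-point test function `F` by integrating out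
the `i`-th variable against `h`, `G(x̂) = ∫ F(x̂ with t inserted at i) h(t) dt` (style of A3
`IsTensorOf`; Mathlib `Fin.insertNth`). [folklore] -/
def IsSliceIntegralOf {n : ℕ} (G : 𝓢((Fin n → EuclideanSpace ℝ (Fin 4)), ℂ))
    (F : 𝓢((Fin (n + 1) → EuclideanSpace ℝ (Fin 4)), ℂ)) (h : EuclideanSpace ℝ (Fin 4) → ℂ)
    (i : Fin (n + 1)) : Prop :=
  ∀ y : Fin n → EuclideanSpace ℝ (Fin 4),
    G y = ∫ t : EuclideanSpace ℝ (Fin 4), F (Fin.insertNth i t y) * h t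

/-- Witness predicate: `F'` is the test function `F` multiplied by `h` in the `i`-th variable,
`F'(x) = F(x) h(xᵢ)` (style of A3 `IsTensorOf`). [folklore] -/
def IsSliceMulOf {n : ℕ} (F' F : 𝓢((Fin n → EuclideanSpace ℝ (Fin 4)), ℂ))
    (h : EuclideanSpace ℝ (Fin 4) → ℂ) (i : Fin n) : Prop :=
  ∀ x : Fin n → EuclideanSpace ℝ (Fin 4), F' x = F x * h (x i)

/-- An **admissible infinitesimal residual gauge parameter** for the axial gauge `A₀ = 0`:
`ω : ℝ⁴ → M₂(ℂ)` smooth with derivatives of temperate growth (so that it multiplies Schwartz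
functions), `𝔰𝔲(2)`-valued and independent of `x₀` (`IsAxialResidual e₀`), hence generating gauge
transformations `exp ω` that preserve the axial gauge (Kummer 1975 §2; MRS CMP 155 (1993) §1).
Documentation of the design decision only: this predicate (and `residualGaugeParameters`) is
*not* consumed by any target statement, because the corresponding inhomogeneous identities are
inconsistent (see `SatisfiesSlavnovIdentitiesOn`); only the subclass `globalGaugeParameters` is
used. [cite: Kummer1975, §2] -/
def IsResidualGaugeParameter
    (ω : EuclideanSpace ℝ (Fin 4) → Matrix (Fin 2) (Fin 2) ℂ) : Prop :=
  Function.HasTemperateGrowth ω ∧ (∀ x, ω x ∈ suAlgebra 2) ∧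
    IsAxialResidual axialDirection ω

/-- The **Slavnov (Ward) variation** of the `(n+1)`-point Schwinger function `𝔖^ι(F)` under the
infinitesimal gauge transformation `δA_μ = D_μ ω = ∂_μ ω + [A_μ, ω]` (A14 `covDeriv A ω x e_μ`)
inserted at the `i`-th field, `ι i = (μ, p, q)`:
`⟨⋯ (∂_μ ω)_{pq}(xᵢ) ⋯⟩ + ∑_r ⟨⋯ (A_μ)_{pr}(xᵢ) ω_{rq}(xᵢ) ⋯⟩ - ∑_r ⟨⋯ ω_{pr}(xᵢ) (A_μ)_{rq}(xᵢ) ⋯⟩`,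
written on `S` with the sliced test functions `G` (the `i`-th variable integrated out against
`(∂_μ ω)_{pq}`) and `Fr r`, `Fl r` (`F` multiplied by `ω_{rq}(xᵢ)`, resp. `ω_{pr}(xᵢ)`)
supplied as arguments (their defining equations are the witness predicates
`IsSliceIntegralOf`/`IsSliceMulOf` in `SatisfiesSlavnovIdentities`). [folklore] -/
def slavnovVariation (S : YMSchwingerFamily) {n : ℕ} (ι : Fin (n + 1) → GaugeFieldIndex)
    (i : Fin (n + 1)) (G : 𝓢((Fin n → EuclideanSpace ℝ (Fin 4)), ℂ))
    (Fr Fl : Fin 2 → 𝓢((Fin (n + 1) → EuclideanSpace ℝ (Fin 4)), ℂ)) : ℂ :=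
  S n (Fin.removeNth i ι) G +
    ∑ r : Fin 2, S (n + 1) (Function.update ι i ((ι i).1, (ι i).2.1, r)) (Fr r) -
    ∑ r : Fin 2, S (n + 1) (Function.update ι i ((ι i).1, r, (ι i).2.2)) (Fl r)

/-- The **global (constant) gauge parameters**: constant `𝔰𝔲(2)`-valued `ω`, generating the
global `SU(2)` conjugations `A ↦ U A U⁻¹`, an exact symmetry of the (regularised or not)
axial-gauge Yang–Mills measure in any volume (MRS CMP 155 (1993) §1). [folklore] -/
def globalGaugeParameters : Set (EuclideanSpace ℝ (Fin 4) → Matrix (Fin 2) (Fin 2) ℂ) :=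
  {ω | ∃ X ∈ suAlgebra 2, ω = fun _ => X}

/-- The **residual (`x₀`-independent) gauge parameters** of the axial gauge, as a set
(`IsResidualGaugeParameter`; Kummer 1975 §2). Not consumed by any target statement (see
`IsResidualGaugeParameter`). [cite: Kummer1975, §2] -/
def residualGaugeParameters : Set (EuclideanSpace ℝ (Fin 4) → Matrix (Fin 2) (Fin 2) ℂ) :=
  {ω | IsResidualGaugeParameter ω}

/-- Constant `𝔰𝔲(2)`-valued parameters are residual gauge parameters. [folklore] -/
theorem globalGaugeParameters_subset_residualGaugeParameters :
    globalGaugeParameters ⊆ residualGaugeParameters := by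
  rintro ω ⟨X, hX, rfl⟩
  exact ⟨Function.HasTemperateGrowth.const X, fun _ => hX, fun _ _ => rfl⟩

/-- `S` **satisfies the Slavnov (Ward) identities for the class `Ω` of infinitesimal gauge
parameters** (*schematic*): for every `ω ∈ Ω`, every `(n+1)`-point test function `F` and
indices `ι`, the total gauge variation `∑ᵢ δ_ω^{(i)} 𝔖^ι(F)` under `δA_μ = ∂_μ ω + [A_μ, ω]`
vanishes, where the `i`-th variation is `slavnovVariation` evaluated on any witnesses of the
sliced test functions (`IsSliceIntegralOf`/`IsSliceMulOf`). MRS CMP 155 (1993) Thm. 1: "the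
Schwinger functions … satisfy the Slavnov identities" (Slavnov 1972; Taylor 1971; Kummer 1975
for the axial gauge). The class `Ω` is a parameter because the admissible class matters: for
`Ω = globalGaugeParameters` (constant `ω`, the `∂ω`-term drops out) these are the exact global
`SU(2)`-covariance Ward identities; for `Ω = residualGaugeParameters` (all `x₀`-independent
`ω`) the inhomogeneous identities are *inconsistent* with a normalised `0`-point function
`S 0 F = F(pt)` (take `n = 0`, `ω = x₁ T`: tracing `x₁ ad(⟨A₁⟩) = -id` over `𝔰𝔲(2)` gives
`0 = -3`), reflecting that `A ↦ A + Dω` is not a symmetry of any IR-cut-off axial-gauge measure —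
which is why MRS *regularise* the axial gauge. MRS's regularisation-specific Slavnov identities
are not transcribed. [cite: Slavnov1972] -/
def SatisfiesSlavnovIdentitiesOn (Ω : Set (EuclideanSpace ℝ (Fin 4) → Matrix (Fin 2) (Fin 2) ℂ))
    (S : YMSchwingerFamily) : Prop :=
  ∀ ω ∈ Ω, ∀ (n : ℕ) (ι : Fin (n + 1) → GaugeFieldIndex)
      (F : 𝓢((Fin (n + 1) → EuclideanSpace ℝ (Fin 4)), ℂ))
      (G : Fin (n + 1) → 𝓢((Fin n → EuclideanSpace ℝ (Fin 4)), ℂ))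
      (Fr Fl : Fin (n + 1) → Fin 2 → 𝓢((Fin (n + 1) → EuclideanSpace ℝ (Fin 4)), ℂ)),
      (∀ i, IsSliceIntegralOf (G i) F
        (fun t => fderiv ℝ (fun y => ω y (ι i).2.1 (ι i).2.2) t
          (EuclideanSpace.single (ι i).1 1)) i) →
      (∀ i r, IsSliceMulOf (Fr i r) F (fun t => ω t r (ι i).2.2) i) →
      (∀ i r, IsSliceMulOf (Fl i r) F (fun t => ω t (ι i).2.1 r) i) →
      ∑ i, slavnovVariation S ι i (G i) (Fr i) (Fl i) = 0

/-- The Slavnov identities are antitone in the class of gauge parameters. [folklore] -/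
theorem SatisfiesSlavnovIdentitiesOn.anti
    {Ω Ω' : Set (EuclideanSpace ℝ (Fin 4) → Matrix (Fin 2) (Fin 2) ℂ)} {S : YMSchwingerFamily}
    (h : SatisfiesSlavnovIdentitiesOn Ω' S) (hΩ : Ω ⊆ Ω') : SatisfiesSlavnovIdentitiesOn Ω S :=
  fun ω hω => h ω (hΩ hω)

/-- The zero family satisfies the Slavnov identities for any class (linearity sanity check). [folklore] -/
theorem satisfiesSlavnovIdentitiesOn_zero
    (Ω : Set (EuclideanSpace ℝ (Fin 4) → Matrix (Fin 2) (Fin 2) ℂ)) :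
    SatisfiesSlavnovIdentitiesOn Ω 0 := by
  intro ω _ n ι F G Fr Fl _ _ _
  simp [slavnovVariation]

/-- `S` **satisfies the Slavnov identities** in the form consumed by
`MagnenRivasseauSeneorYM4`: the Ward identities of *global* `SU(2)` gauge covariance
(`SatisfiesSlavnovIdentitiesOn globalGaugeParameters`), i.e. only the homogeneous
(`x`-independent) part of the axial-gauge Slavnov identities is transcribed (*schematic*; MRS
CMP 155 (1993) Thm. 1; see `SatisfiesSlavnovIdentitiesOn` for why the inhomogeneous residual
identities are not the right rendering). [folklore] -/
def SatisfiesSlavnovIdentities (S : YMSchwingerFamily) : Prop :=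
  SatisfiesSlavnovIdentitiesOn globalGaugeParameters S

/-- The zero family satisfies the Slavnov identities. [folklore] -/
theorem satisfiesSlavnovIdentities_zero : SatisfiesSlavnovIdentities 0 :=
  satisfiesSlavnovIdentitiesOn_zero _

/-- The **trivial gauge-field Schwinger family** (Schwinger functions of the Dirac measure at the
zero connection): `𝔖₀(F) = F(pt)` and `𝔖ₙ = 0` for `n ≥ 1`. Used as a positive sanity check
for `SatisfiesSlavnovIdentities` (it has the normalised `0`-point function that any UV limit
`AxialGaugeYMRegularisation.HasUVLimit` has). Evaluation is Mathlib's
`BoundedContinuousFunction.evalCLM ∘ SchwartzMap.toBoundedContinuousFunctionCLM` (as in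
`TemperedDistribution.delta`). [folklore] -/
def trivialYMSchwingerFamily : YMSchwingerFamily
  | 0, _ => (BoundedContinuousFunction.evalCLM ℂ default).comp
      (SchwartzMap.toBoundedContinuousFunctionCLM ℂ _ ℂ)
  | _ + 1, _ => 0

/-- The `0`-point function of the trivial family is evaluation. [folklore] -/
@[simp] theorem trivialYMSchwingerFamily_zero_apply (ι : Fin 0 → GaugeFieldIndex)
    (F : 𝓢((Fin 0 → EuclideanSpace ℝ (Fin 4)), ℂ)) :
    trivialYMSchwingerFamily 0 ι F = F default := rfl

/-- The `n`-point functions, `n ≥ 1`, of the trivial family vanish. [folklore] -/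
@[simp] theorem trivialYMSchwingerFamily_succ (n : ℕ) (ι : Fin (n + 1) → GaugeFieldIndex) :
    trivialYMSchwingerFamily (n + 1) ι = 0 := rfl

/-- Positive sanity check: the trivial family (normalised `0`-point function) satisfies the
global Slavnov identities — the check that fails for the inhomogeneous residual class. [folklore] -/
theorem satisfiesSlavnovIdentities_trivial :
    SatisfiesSlavnovIdentities trivialYMSchwingerFamily := by
  rintro ω ⟨X, hX, rfl⟩ n ι F G Fr Fl hG _ _
  cases n with
  | zero =>
    refine Finset.sum_eq_zero fun i _ => ?_
    simp only [slavnovVariation, trivialYMSchwingerFamily_succ, zero_apply,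
      Finset.sum_const_zero, add_zero, sub_zero, trivialYMSchwingerFamily_zero_apply]
    rw [hG i]
    simp
  | succ m => simp [slavnovVariation]

/-- The trivial family fails the non-degeneracy conjunct `S 2 ≠ 0` of `MagnenRivasseauSeneorYM4`
(so the trivial "UV limit" of a Dirac-pair reference is excluded). [folklore] -/
theorem trivialYMSchwingerFamily_two_eq_zero : trivialYMSchwingerFamily 2 = 0 := rfl

/-- The finite Euclidean volume of MRS: the cube `[0, L]⁴ ⊆ ℝ⁴` (infrared cutoff; MRS CMP 155
(1993) §1), as the preimage of the box `Set.univ.pi fun _ => Set.Icc 0 L` under the coercion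
`EuclideanSpace ℝ (Fin 4) → (Fin 4 → ℝ)` (Mathlib `Set.pi`; review r02500B). For `L < 0` it is
empty and for `L = 0` it is `{0}`; `MagnenRivasseauSeneorYM4` only uses `L > 0`. [folklore] -/
def mrsCube (L : ℝ) : Set (EuclideanSpace ℝ (Fin 4)) :=
  (fun x : EuclideanSpace ℝ (Fin 4) => (⇑x : Fin 4 → ℝ)) ⁻¹' Set.univ.pi fun _ => Set.Icc 0 L

/-- Membership in the MRS cube. [folklore] -/
theorem mem_mrsCube_iff (L : ℝ) (x : EuclideanSpace ℝ (Fin 4)) :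
    x ∈ mrsCube L ↔ ∀ i, 0 ≤ x i ∧ x i ≤ L := by
  simp only [mrsCube, Set.mem_preimage, Set.mem_univ_pi, Set.mem_Icc]

/-- The MRS cube is bounded. [folklore] -/
theorem isBounded_mrsCube (L : ℝ) : Bornology.IsBounded (mrsCube L) := by
  rw [Metric.isBounded_iff_subset_closedBall (0 : EuclideanSpace ℝ (Fin 4))]
  refine ⟨Real.sqrt (∑ _i : Fin 4, L ^ 2), fun x hx => ?_⟩
  rw [Metric.mem_closedBall, dist_zero_right, EuclideanSpace.norm_eq]
  gcongr with i
  have := (mem_mrsCube_iff L x).1 hx i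
  rw [Real.norm_eq_abs]
  exact abs_le.2 ⟨by linarith [this.1, this.2], this.2⟩

/-- **constructive-qft.S21** (Magnen–Rivasseau–Sénéor, *Construction of `YM₄` with an infrared
cutoff*, CMP 155 (1993) 325–383; the source has NO numbered theorem — its statement is the
italic display of §I, p. 327: "The ultraviolet limit as `ρ → ∞` of the Schwinger functions
which are the moments of the bare measure defined below in (II.77) exists; fu[r]thermore these
functions in the ultraviolet limit satisfy the Slavnov identities (VIII.6) adapted to the
particular infrared cutoff chosen", with (VIII.6) on p. 378 and the bare axial-gauge ansatz
(II.40) p. 340 completed by (II.76)–(II.77) p. 346). In every finite volume `[0, L]⁴` (fixed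
infrared cutoff) there is `g₀ > 0` such that for every renormalised coupling `0 < g < g₀` the
Schwinger functions of continuum `SU(2)` Yang–Mills theory in the regularised axial gauge and
trivial topological sector exist as limits of UV-regularised functional integrals (convergent
expansion, bounds uniform in the UV cutoff), are non-trivial (the gauge-field two-point
function does not vanish identically; MRS construct an interacting, in particular non-zero,
family) and satisfy the Slavnov identities. *Status of the source, in its own words*: "We do
not claim to provide here the proofs of convergence of our expansion in all detail" (p. 326);
"In this paper we do not provide a detailed proof of this statement but we give all the
elements necessary to write such a proof … the writing up of such a detailed self-contained
proof, which would presumably be several hundred pages long, remains an extremely valuable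
task" (p. 327); "This achieves our sketch of proof of the main statement in the introduction"
(p. 378, end of §VIII). OS positivity is not treated ("we cannot study the complete set of
Osterwalder-Schrader axioms", p. 327) and the infrared cutoff is never removed (p. 327).

*Schematic*: both predicates `IsRegularisedAxialGaugeYMLimit` (over the hypothesis structure
`AxialGaugeYMRegularisation` on the carrier `AxialConfig`, A14 vocabulary) and
`SatisfiesSlavnovIdentities` (global `SU(2)`-covariance Ward identities only) are v0 renderings
flagged in their docstrings; the volume is universally quantified over cubes `[0, L]⁴`, `L > 0`
(outline: `∃ Λvol`, bounded; this avoids the vacuous witness `Λvol = ∅`, and all cubes are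
equivalent by scaling). Non-degeneracy: the conjunct `S 2 ≠ 0` excludes the trivial family
`trivialYMSchwingerFamily` (which satisfies the Slavnov identities,
`satisfiesSlavnovIdentities_trivial`, and would be the "UV limit" of degenerate data), and
`AxialGaugeYMRegularisation.nullSingleton_ref` (a genuine condition on `AxialConfig`, where
singletons are measurable) excludes Dirac-type reference measures such as `½(δ₀ + δ_{A_κ})`
with `S_Λ(A_κ) → ∞`. Refutability status (review r01907B): the previous rendering put the laws
on the raw product σ-algebra of `ℝ⁴ → (ℝ⁴ →L[ℝ] M₂(ℂ))`, where the a.e. axial-gauge constraint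
made the hypothesis structure empty and the proposition refutable; on the subtype carrier the
structure has (informal) finite-mode Gaussian witnesses (docstring of
`AxialGaugeYMRegularisation`), so this refutation is gone. Faithfulness status: because the
regularisation `ref κ` is existentially quantified data constrained only in shape (atomless,
local counterterms with nonnegative field-strength coefficient, divergent expected action), the
proposition as rendered is much *weaker* than MRS's theorem and presumably admits artificial
witnesses not related to Yang–Mills theory (finite-mode Gaussian references
`A = ∑_{j < m_κ} ξ_j h_j` with fixed smooth axial `𝔰𝔲(2)`-valued modes, arranged — e.g. by
global-`SU(2)`-invariant families of modes and suitable mass counterterms — so that the Gibbs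
tilts have convergent, non-zero, `SU(2)`-covariant moments); it fixes the *shape* of S21, not
its analytic content, and is **not asserted**. [folklore] -/
def MagnenRivasseauSeneorYM4 : Prop :=
  ∀ L : ℝ, 0 < L → ∃ g₀ : ℝ, 0 < g₀ ∧ ∀ g ∈ Set.Ioo 0 g₀,
    ∃ S : YMSchwingerFamily,
      IsRegularisedAxialGaugeYMLimit (mrsCube L) g S ∧ S 2 ≠ 0 ∧ SatisfiesSlavnovIdentities S

end MRS

end Literature.MathematicalPhysics.QuantumFieldTheory
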